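import Summits.ValiantsHypothesis.ValiantsHypothesis.Theorems.KPlusLogSqLawTropicalBSplitDefs

/-!
# Route «KPlusLogSqLaw», crux `TropicalB` (stmt-ValiantsHypothesis-19771) — the CLASS-DROP LAW:
# the terms of a dominant chain that avoid a class live in the smaller format

HONEST FRAMING.  Helper file of the object-search cell `pub-symmetroid` (seat val-sym-trop-p3 g12, 2026-08-28) for the crux
`Summit.ValiantsHypothesis.ValiantsHypothesis.Theses.KPlusLogSqLaw.TropicalB` (ledger item `stmt-ValiantsHypothesis-19771`, route
`KPlusLogSqLaw`; registered stubs `stub_tropThin` / `stub_tropFat` of `Cruxes/TropicalB/Lines/birth.lean`, each ⟺ the crux), landed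
`--supports`; it does NOT close the item and asserts nothing about `TropicalB` in its window, `WeakLifting`, `KPlusLogSqLaw`,
`MatrixDescartes` (stmt-ValiantsHypothesis-18050) or `VP ≠ VNP`.  A STRUCTURE law about unique optima (`IsDominant`) of an ARBITRARY
design, every format, no exponent regime, no support hypothesis: a RELATIVE statement (it compares the unsigned rows `TropRowD m K ·` of two
consecutive class numbers), not an absolute census value.

THE LAW.  Delete a class `l₀` from a design of format `(m, K+1)` (re-index the remaining classes along `l₀.succAbove`).  A term of the big
design that uses no incidence of class `l₀` IS a term of the small design, and if it is the unique optimum of the big design at slope `θ` it is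
the unique optimum of the small one at `θ` (fewer competitors, same weights: `ClassDrop.isDominant_drop`).  Hence along any unsigned dominant
chain of format `(m, K+1)` (unique optima at strictly increasing integer slopes, consecutive terms distinct) the terms avoiding `l₀` form — in
the induced order — an unsigned dominant chain of format `(m, K)`; so
* `ClassDrop.card_filter_avoid_le`   — `TropRowD m K B →` at most `B + 1` terms of the chain avoid a given class `l₀`;
* `ClassDrop.card_filter_nonfull_le` — `TropRowD m K B →` at most `(K+1)·(B+1)` terms of the chain have a class histogram WITH A ZERO ENTRY
  (all the other terms use every one of the `K+1` classes);
* `ClassDrop.tropRowD_succ_of_le`    — in the super-fat corner `m ≤ K` no term can use all `K+1` classes, so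
  `TropRowD m K B → m ≤ K → TropRowD m (K+1) ((K+1)·(B+1) − 1)`: ONE MORE SLOPE CLASS MULTIPLIES `T_D + 1` BY AT MOST `K + 1` there
  (a relative growth law for the super-fat slope; counting alone compares absolute ceilings);
(The signed reading `TropRootLawAt m K B → m ≤ K → TropRootLawAt m (K+1) ((K+1)·(2B+1) − 1)` follows with the tree's
`tropRowD_of_tropRootLawAt` / `tropRootLawAt_of_tropRowD`; it is not restated here to keep this file independent of the route file.)
READING (located, not claimed): inside the window `K + 1 ≤ m` the law says that a long chain consists, up to `(K+1)(T_D(m,K)+1)` exceptions, of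
terms whose histograms have FULL support — the terms a «rare-class peeling» argument would have to control.

[folklore] restriction of an optimisation problem to a sub-family of feasible solutions containing the optimum; packaging of the cell.
-/

set_option linter.dupNamespace false
set_option autoImplicit false

namespace Summit.ValiantsHypothesis.ValiantsHypothesis.Theorems.KPlusLogSqLaw

open Summit.ValiantsHypothesis.ValiantsHypothesis.Theorems.MatrixDescartes.Negative
open Summit.ValiantsHypothesis.ValiantsHypothesis.Theorems.LacunarySymmetroidMatrixDescartes
open Summit.ValiantsHypothesis.ValiantsHypothesis.Theorems.LacunarySymmetroidMatrixDescartes.TropicalCensus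
open scoped BigOperators
open Finset

namespace ClassDrop

variable {m K : ℕ}

/-- The sign of a term of the class-deleted design is the sign of the re-embedded term of the big design (definitional). [folklore] -/
theorem termSign_drop (ε : Fin m → Fin m → Fin (K + 1) → ℤ) (l₀ : Fin (K + 1)) (σ : Equiv.Perm (Fin m))
    (μ : Fin m → Fin K) :
    termSign (fun i j l => ε i j (l₀.succAbove l)) (σ, μ) = termSign ε (σ, l₀.succAbove ∘ μ) := rfl

/-- The tropical weight of a term of the class-deleted design is the weight of the re-embedded term (definitional). [folklore] -/
theorem tropWeight_drop (d : Fin (K + 1) → ℕ) (v : Fin m → Fin m → Fin (K + 1) → ℤ) (l₀ : Fin (K + 1)) (θ : ℤ)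
    (σ : Equiv.Perm (Fin m)) (μ : Fin m → Fin K) :
    tropWeight (d ∘ l₀.succAbove) (fun i j l => v i j (l₀.succAbove l)) θ (σ, μ) =
      tropWeight d v θ (σ, l₀.succAbove ∘ μ) := rfl

/-- **Class deletion preserves dominance.**  If a term avoiding class `l₀` (written `(σ, l₀.succAbove ∘ μ)`) is the unique optimum of the
design `(d, v, ε)` at slope `θ`, then `(σ, μ)` is the unique optimum at `θ` of the design with class `l₀` deleted: its competitors there are
competitors of the big design avoiding `l₀`, with the same weights. [folklore] -/
theorem isDominant_drop (d : Fin (K + 1) → ℕ) (v ε : Fin m → Fin m → Fin (K + 1) → ℤ) (l₀ : Fin (K + 1)) (θ : ℤ)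
    (σ : Equiv.Perm (Fin m)) (μ : Fin m → Fin K) (h : IsDominant d v ε θ (σ, l₀.succAbove ∘ μ)) :
    IsDominant (d ∘ l₀.succAbove) (fun i j l => v i j (l₀.succAbove l)) (fun i j l => ε i j (l₀.succAbove l)) θ
      (σ, μ) := by
  refine ⟨?_, ?_⟩
  · rw [termSign_drop]; exact h.1
  · rintro ⟨τ, ν⟩ hne hq
    rw [termSign_drop] at hq
    rw [tropWeight_drop, tropWeight_drop]
    refine h.2 (τ, l₀.succAbove ∘ ν) ?_ hq
    intro heq
    apply hne
    have h1 : τ = σ := congrArg Prod.fst heq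
    have h2 : l₀.succAbove ∘ ν = l₀.succAbove ∘ μ := congrArg Prod.snd heq
    have h3 : ν = μ := funext fun i => Fin.succAbove_right_injective (congrFun h2 i)
    rw [h1, h3]

/-- **The class-drop law (unsigned row).**  `TropRowD m K B →` along every unsigned dominant chain of a design of format `(m, K+1)` at most
`B + 1` terms avoid a given class `l₀`: listed in increasing order they form an unsigned dominant chain of the class-deleted design of format
`(m, K)`. [folklore] -/
theorem card_filter_avoid_le {B : ℕ} (hrow : TropRowD m K B) (d : Fin (K + 1) → ℕ)
    (v ε : Fin m → Fin m → Fin (K + 1) → ℤ) (l₀ : Fin (K + 1)) {n : ℕ} (θ : Fin (n + 1) → ℤ)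
    (p : Fin (n + 1) → Equiv.Perm (Fin m) × (Fin m → Fin (K + 1))) (hθ : StrictMono θ)
    (hdom : ∀ k, IsDominant d v ε (θ k) (p k)) (hne : ∀ k : Fin n, p k.castSucc ≠ p k.succ) :
    (univ.filter fun k => ∀ i, (p k).2 i ≠ l₀).card ≤ B + 1 := by
  classical
  set S := univ.filter fun k : Fin (n + 1) => ∀ i, (p k).2 i ≠ l₀ with hS
  rcases Nat.eq_zero_or_pos S.card with h0 | hpos
  · omega
  obtain ⟨n', hn'⟩ : ∃ n', S.card = n' + 1 := ⟨S.card - 1, by omega⟩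
  -- enumerate the avoiding positions increasingly
  let e : Fin (n' + 1) ↪o Fin (n + 1) := S.orderEmbOfFin hn'
  have hmem : ∀ k, e k ∈ S := fun k => S.orderEmbOfFin_mem hn' k
  have havoid : ∀ k i, (p (e k)).2 i ≠ l₀ := fun k => (mem_filter.mp (hmem k)).2
  -- lift the class maps through `l₀.succAbove`
  choose μ hμ using fun k i => Fin.exists_succAbove_eq (havoid k i)
  have hp : ∀ k, p (e k) = ((p (e k)).1, l₀.succAbove ∘ μ k) :=
    fun k => Prod.ext rfl (funext fun i => (hμ k i).symm)
  -- the dropped chain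
  have hθ' : StrictMono fun k => θ (e k) := hθ.comp e.strictMono
  have hdom' : ∀ k, IsDominant (d ∘ l₀.succAbove) (fun i j l => v i j (l₀.succAbove l))
      (fun i j l => ε i j (l₀.succAbove l)) (θ (e k)) ((p (e k)).1, μ k) := by
    intro k
    apply isDominant_drop
    rw [← hp k]
    exact hdom (e k)
  have hinj := injective_of_chainD d v ε θ p hθ hdom hne
  have hne' : ∀ k : Fin n', ((p (e k.castSucc)).1, μ k.castSucc) ≠ ((p (e k.succ)).1, μ k.succ) := by
    intro k heq
    obtain ⟨h1, h2⟩ := Prod.mk_inj.mp heq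
    have hpp : p (e k.castSucc) = p (e k.succ) := by
      rw [hp k.castSucc, hp k.succ, h1, h2]
    have hk : k.castSucc = k.succ := e.injective (hinj hpp)
    exact absurd hk (ne_of_lt Fin.castSucc_lt_succ)
  have hle := hrow (d ∘ l₀.succAbove) _ _ n' (fun k => θ (e k)) (fun k => ((p (e k)).1, μ k)) hθ' hdom' hne'
  omega

/-- **Few terms miss a class.**  `TropRowD m K B →` along every unsigned dominant chain of a design of format `(m, K+1)`, at most
`(K+1)·(B+1)` terms have a class histogram with a zero entry (i.e. avoid some class); every other term uses all `K+1` classes. [folklore] -/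
theorem card_filter_nonfull_le {B : ℕ} (hrow : TropRowD m K B) (d : Fin (K + 1) → ℕ)
    (v ε : Fin m → Fin m → Fin (K + 1) → ℤ) {n : ℕ} (θ : Fin (n + 1) → ℤ)
    (p : Fin (n + 1) → Equiv.Perm (Fin m) × (Fin m → Fin (K + 1))) (hθ : StrictMono θ)
    (hdom : ∀ k, IsDominant d v ε (θ k) (p k)) (hne : ∀ k : Fin n, p k.castSucc ≠ p k.succ) :
    (univ.filter fun k => ∃ l₀, ∀ i, (p k).2 i ≠ l₀).card ≤ (K + 1) * (B + 1) := by
  classical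
  have hsub : (univ.filter fun k => ∃ l₀, ∀ i, (p k).2 i ≠ l₀) ⊆
      (univ : Finset (Fin (K + 1))).biUnion fun l₀ => univ.filter fun k => ∀ i, (p k).2 i ≠ l₀ := by
    intro k hk
    rw [mem_filter] at hk
    obtain ⟨l₀, hl₀⟩ := hk.2
    rw [mem_biUnion]
    exact ⟨l₀, mem_univ _, mem_filter.mpr ⟨mem_univ _, hl₀⟩⟩
  calc (univ.filter fun k => ∃ l₀, ∀ i, (p k).2 i ≠ l₀).card
      ≤ ((univ : Finset (Fin (K + 1))).biUnion fun l₀ => univ.filter fun k => ∀ i, (p k).2 i ≠ l₀).card :=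
        card_le_card hsub
    _ ≤ ∑ l₀, (univ.filter fun k => ∀ i, (p k).2 i ≠ l₀).card := card_biUnion_le
    _ ≤ ∑ _l₀ : Fin (K + 1), (B + 1) :=
        sum_le_sum fun l₀ _ => card_filter_avoid_le hrow d v ε l₀ θ p hθ hdom hne
    _ = (K + 1) * (B + 1) := by simp

/-- **One more class in the super-fat corner.**  `TropRowD m K B → m ≤ K → TropRowD m (K+1) ((K+1)·(B+1) − 1)`: with `m ≤ K` a term of format
`(m, K+1)` cannot use all `K+1` classes (pigeonhole), so every term of a chain misses a class and `card_filter_nonfull_le` bounds the whole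
chain.  Adding one slope class multiplies `T_D + 1` by at most `K + 1` there. [folklore] -/
theorem tropRowD_succ_of_le {B : ℕ} (hrow : TropRowD m K B) (hmK : m ≤ K) :
    TropRowD m (K + 1) ((K + 1) * (B + 1) - 1) := by
  classical
  intro d v ε n θ p hθ hdom hne
  have hall : (univ.filter fun k : Fin (n + 1) => ∃ l₀, ∀ i, (p k).2 i ≠ l₀) = univ := by
    apply filter_true_of_mem
    intro k _
    by_contra hcon
    push Not at hcon
    have hsurj : Function.Surjective (p k).2 := fun l₀ => hcon l₀
    have hcard := Fintype.card_le_of_surjective _ hsurj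
    simp only [Fintype.card_fin] at hcard
    omega
  have h := card_filter_nonfull_le hrow d v ε θ p hθ hdom hne
  rw [hall, card_univ, Fintype.card_fin] at h
  have h1 : 1 ≤ (K + 1) * (B + 1) := Nat.one_le_iff_ne_zero.mpr (Nat.mul_ne_zero (Nat.succ_ne_zero K) (Nat.succ_ne_zero B))
  omega

end ClassDrop

end Summit.ValiantsHypothesis.ValiantsHypothesis.Theorems.KPlusLogSqLaw
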